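import Literature.MathematicalPhysics.QuantumManyBody.BoseEinsteinCondensation
import Mathlib.MeasureTheory.Integral.MeanInequalities
import Mathlib.MeasureTheory.Integral.Prod
import Mathlib.MeasureTheory.Constructions.Pi
import HarnessLib

/-!
# The swap purity `tr(γ_Ψ²)/N²` of an `N`-boson wave function

Topic `Literature/MathematicalPhysics/QuantumManyBody`; definition request `defn-swapPurity` (route
`BECSwapAffinity` of the conjunct `BoseEinsteinCondensation` of `AtomisticToContinuum`, items
`SwapJensen` / `TraceSqLower` / `SwapPurityImpliesBEC`, which inline the term verbatim). Companion
of `Literature.MathematicalPhysics.QuantumManyBody.BoseGas.occupation` / `maxOccupation`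
(`BoseEinsteinCondensation.lean`) and of
`Literature.MathematicalPhysics.QuantumManyBody.BoseGas.PenroseOnsager.kernelA2`
(`PenroseOnsager1956.lean`).

For `Ψ : (ℝ³)^{n+1} → ℂ`, `N = n + 1`, write `Ψ_X̂(x) = Ψ(x, X̂)` for the slice at fixed last `n`
coordinates `X̂ ∈ (ℝ³)ⁿ` (the splitting `x :: X̂ = Matrix.vecCons x X̂` of
`Literature.MathematicalPhysics.QuantumManyBody.BoseGas.occupation`) and
`K(X̂, Ŷ) = ∫ Ψ(x, X̂) conj Ψ(x, Ŷ) dx = ⟨Ψ_Ŷ, Ψ_X̂⟩`. The one-particle density matrix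
`γ_Ψ(x, x') = N ∫ Ψ(x, X̂) conj Ψ(x', X̂) dX̂` [LSSY2005, (1.17)] satisfies
`tr γ_Ψ² = ∫∫ |γ_Ψ(x, x')|² dx dx' = N² ∫∫ |K(X̂, Ŷ)|² dX̂ dŶ` (expand the squares, Fubini), so

  `swapPurity n Ψ := ∫∫ |K(X̂, Ŷ)|² dX̂ dŶ = tr(γ_Ψ²)/N²`

is Penrose–Onsager's functional **(6)** `A₂ = N⁻² ∫∫ |⟨q'|σ₁|q''⟩|² = N⁻² ∑ₐ nₐ²` for `σ₁ = γ_Ψ`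
[PenroseOnsager1956, §4 (6)], i.e. the purity `tr ρ₁²` of the normalised one-particle density
matrix `ρ₁ = γ_Ψ/N`. In path-integral language it is the expectation of the operator swapping ONE
particle between two independent replicas of the state (the `n = 1` instance of the
`n`-particle-partition SWAP estimator of the second Rényi entropy, `tr ρ₁² = e^{-S₂(n=1)}`)
[HerdmanEtAl2014]; for real nonnegative `Ψ` it is the Bhattacharyya affinity `∫ √(p q)` of
`p = |Ψ|² ⊗ |Ψ|²` and its image `q` under the exchange of one coordinate between the replicas.

* `swapPurity` — the definition, in the `K`-form above (verbatim the term inlined in the route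
  items, see `swapPurity_def`).
* `measurable_vecCons`, `lintegral_config_succ` — Tonelli for `(ℝ³)^{n+1} ≅ ℝ³ × (ℝ³)ⁿ`,
  `∫ F dZ = ∫ (∫ F(x :: Ŷ) dx) dŶ`.
* `sq_nnnorm_integral_mul_conj_le` — Cauchy–Schwarz `|K(X̂, Ŷ)|² ≤ ‖Ψ_X̂‖₂² ‖Ψ_Ŷ‖₂²`.
* `swapPurity_le_lintegral_sq` — `swapPurity ≤ ‖Ψ‖₂⁴`; `swapPurity_le_one` for `‖Ψ‖₂ ≤ 1`
  (`A₂ ≤ 1`: the purity of a density matrix is at most one).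
* `succ_mul_swapPurity_le` — **Penrose–Onsager (5), right inequality, with (6)**:
  `∑ₐ nₐ² ≤ n_M ∑ₐ nₐ`, i.e. `N · swapPurity ≤ λ_max(γ_Ψ) · ‖Ψ‖₂²` with the variational
  `λ_max = maxOccupation` [PenroseOnsager1956, §4 (5)–(6)]; operator-free proof: for the
  normalised slice `φ_Ŷ = Ψ_Ŷ/‖Ψ_Ŷ‖₂`, `N ∫ |K(X̂, Ŷ)|² dX̂ = ‖Ψ_Ŷ‖₂² · occupation N φ_Ŷ Ψ
  ≤ ‖Ψ_Ŷ‖₂² · maxOccupation N Ψ`, then integrate `dŶ`. `succ_mul_swapPurity_le_maxOccupation`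
  is the normalised form `N · swapPurity ≤ maxOccupation` (`tr γ² ≤ N λ_max(γ)`).

Mathlib has no reduced density matrices (searched `densityMatrix`, `purity`, `Renyi`, `swap
operator`); `MeasurableEquiv.piFinSuccAbove`, `volume_preserving_piFinSuccAbove`, Tonelli
(`lintegral_prod_symm`, `lintegral_prod_mul`) and Hölder (`ENNReal.lintegral_mul_le_Lp_mul_Lq`)
are Mathlib's.

## References

* [PenroseOnsager1956] O. Penrose, L. Onsager, *Bose–Einstein condensation and liquid helium*,
  Phys. Rev. 104 (1956) 576–584, doi:10.1103/PhysRev.104.576: §4 (5)–(7).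
* [HerdmanEtAl2014] C. M. Herdman, P.-N. Roy, R. G. Melko, A. Del Maestro, *Particle entanglement
  in continuum many-body systems via quantum Monte Carlo*, Phys. Rev. B 89 (2014) 140501(R),
  doi:10.1103/PhysRevB.89.140501: the replica SWAP/permutation estimator of particle-partition
  Rényi entropies.
* [LSSY2005] E. H. Lieb, R. Seiringer, J. P. Solovej, J. Yngvason, *The Mathematics of the Bose Gas
  and its Condensation*, Birkhäuser 2005: §1.2 (1.17)–(1.18) (`γ_Ψ`, `λ_max`).
-/

noncomputable section

open MeasureTheory
open scoped ENNReal NNReal ComplexConjugate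

namespace Literature.MathematicalPhysics.QuantumManyBody.BoseGas

variable {n : ℕ}

/-- The **swap purity** `tr(γ_Ψ²)/N² = ∫∫ |K(X̂, Ŷ)|² dX̂ dŶ`,
`K(X̂, Ŷ) = ∫ Ψ(x, X̂) conj Ψ(x, Ŷ) dx`, of a wave function `Ψ` of `N = n + 1` particles in `ℝ³`
(first coordinate integrated out, `x :: X̂ = Matrix.vecCons x X̂` as in `occupation`):
Penrose–Onsager's
`A₂ = N⁻² ∫∫ |⟨q'|σ₁|q''⟩|² d³q' d³q'' = N⁻² tr σ₁²` for the one-particle reduced density matrix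
`σ₁ = γ_Ψ`, equivalently the two-replica expectation of the one-particle permutation ("swap")
operator (Herdman–Roy–Melko–Del Maestro 2014, §II, `n = 1`; see
`swapPurity_eq_lintegral_of_nonneg`). Values in `[0, ∞]`; for normalised `Ψ` it lies in `[0, 1]`
(`swapPurity_le_one`) and `N · swapPurity ≤ λ_max(γ_Ψ)` (`succ_mul_swapPurity_le_maxOccupation`).
[cite: PenroseOnsager1956, §4 (6)] -/
def swapPurity (n : ℕ) (Ψ : Config (n + 1) → ℂ) : ℝ≥0∞ :=
  ∫⁻ P : Config n × Config n,
    (‖∫ x, Ψ (Matrix.vecCons x P.1) * conj (Ψ (Matrix.vecCons x P.2))‖₊ : ℝ≥0∞) ^ 2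

/-- Unfolding `swapPurity` (the form inlined in the route items, `conj = starRingEnd ℂ`).
[cite: PenroseOnsager1956, §4 (6)] -/
theorem swapPurity_def (n : ℕ) (Ψ : Config (n + 1) → ℂ) :
    swapPurity n Ψ = ∫⁻ P : Config n × Config n,
      (‖∫ x, Ψ (Matrix.vecCons x P.1) * (starRingEnd ℂ) (Ψ (Matrix.vecCons x P.2))‖₊ : ℝ≥0∞) ^ 2 :=
  rfl

/-! ### Tonelli for the splitting `(ℝ³)^{n+1} ≅ ℝ³ × (ℝ³)ⁿ`, `Z = x :: X̂` -/

/-- Mathlib's `piFinSuccAbove` at the coordinate `0` is (the inverse of) `Matrix.vecCons`.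
[folklore] -/
theorem piFinSuccAbove_symm_apply_eq_vecCons (p : Space × Config n) :
    (MeasurableEquiv.piFinSuccAbove (fun _ : Fin (n + 1) => Space) 0).symm p =
      Matrix.vecCons p.1 p.2 := by
  simp [MeasurableEquiv.piFinSuccAbove_symm_apply, Fin.insertNthEquiv, Fin.insertNth_zero',
    Matrix.vecCons]

/-- `(x, X̂) ↦ x :: X̂` is (jointly) measurable. [folklore] -/
theorem measurable_vecCons : Measurable fun p : Space × Config n => Matrix.vecCons p.1 p.2 :=
  (continuous_fst.matrixVecCons continuous_snd).measurable

/-- `(x, X̂) ↦ x :: X̂` carries `dx ⊗ dX̂` to `dZ` (Lebesgue measures). [folklore] -/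
theorem measurePreserving_vecCons :
    MeasurePreserving (fun p : Space × Config n => Matrix.vecCons p.1 p.2)
      ((volume : Measure Space).prod (volume : Measure (Config n))) volume := by
  have h := (volume_preserving_piFinSuccAbove (fun _ : Fin (n + 1) => Space) 0).symm
  refine ⟨measurable_vecCons, ?_⟩
  have hfun : (fun p : Space × Config n => Matrix.vecCons p.1 p.2) =
      (MeasurableEquiv.piFinSuccAbove (fun _ : Fin (n + 1) => Space) 0).symm :=
    funext fun p => (piFinSuccAbove_symm_apply_eq_vecCons p).symm
  rw [hfun]
  exact h.map_eq

/-- **Tonelli, first coordinate innermost**: `∫ F(Z) dZ = ∫ (∫ F(x :: Ŷ) dx) dŶ` for measurable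
`F ≥ 0` on `(ℝ³)^{n+1}`. [folklore] -/
theorem lintegral_config_succ {F : Config (n + 1) → ℝ≥0∞} (hF : Measurable F) :
    ∫⁻ Z, F Z = ∫⁻ Y : Config n, ∫⁻ x : Space, F (Matrix.vecCons x Y) := by
  rw [← measurePreserving_vecCons.lintegral_comp hF,
    lintegral_prod_symm (fun p : Space × Config n => F (Matrix.vecCons p.1 p.2))
      (hF.comp measurable_vecCons).aemeasurable]

/-- Slices `x ↦ Ψ(x :: Ŷ)` of a measurable `Ψ` are measurable. [folklore] -/
theorem measurable_comp_vecCons_left {Ψ : Config (n + 1) → ℂ} (hΨ : Measurable Ψ) (Y : Config n) :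
    Measurable fun x : Space => Ψ (Matrix.vecCons x Y) :=
  hΨ.comp (measurable_vecCons.comp (measurable_id.prodMk measurable_const))

/-- `∫ (∫ |Ψ(x :: Ŷ)|² dx) dŶ = ‖Ψ‖₂²`: the slice norms `‖Ψ_Ŷ‖₂²` integrate to the norm.
[folklore] -/
theorem lintegral_lintegral_sq_nnnorm_vecCons {Ψ : Config (n + 1) → ℂ} (hΨ : Measurable Ψ) :
    ∫⁻ Y : Config n, ∫⁻ x : Space, (‖Ψ (Matrix.vecCons x Y)‖₊ : ℝ≥0∞) ^ 2 =
      ∫⁻ Z, (‖Ψ Z‖₊ : ℝ≥0∞) ^ 2 :=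
  (lintegral_config_succ (hΨ.nnnorm.coe_nnreal_ennreal.pow_const 2)).symm

/-- `Ŷ ↦ ‖Ψ_Ŷ‖₂² = ∫ |Ψ(x :: Ŷ)|² dx` is measurable. [folklore] -/
theorem measurable_lintegral_sq_nnnorm_vecCons {Ψ : Config (n + 1) → ℂ} (hΨ : Measurable Ψ) :
    Measurable fun Y : Config n => ∫⁻ x : Space, (‖Ψ (Matrix.vecCons x Y)‖₊ : ℝ≥0∞) ^ 2 :=
  ((hΨ.comp measurable_vecCons).nnnorm.coe_nnreal_ennreal.pow_const 2).lintegral_prod_left'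

/-- The swap kernel `(X̂, Ŷ) ↦ K(X̂, Ŷ) = ∫ Ψ(x :: X̂) conj Ψ(x :: Ŷ) dx` is measurable.
[folklore] -/
theorem measurable_swapKernel {Ψ : Config (n + 1) → ℂ} (hΨ : Measurable Ψ) :
    Measurable fun P : Config n × Config n =>
      ∫ x, Ψ (Matrix.vecCons x P.1) * conj (Ψ (Matrix.vecCons x P.2)) := by
  have hG : Measurable fun q : (Config n × Config n) × Space =>
      Ψ (Matrix.vecCons q.2 q.1.1) * conj (Ψ (Matrix.vecCons q.2 q.1.2)) := by
    have h1 : Measurable fun q : (Config n × Config n) × Space => Ψ (Matrix.vecCons q.2 q.1.1) :=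
      hΨ.comp (measurable_vecCons.comp (measurable_snd.prodMk (measurable_fst.comp measurable_fst)))
    have h2 : Measurable fun q : (Config n × Config n) × Space => Ψ (Matrix.vecCons q.2 q.1.2) :=
      hΨ.comp (measurable_vecCons.comp (measurable_snd.prodMk (measurable_snd.comp measurable_fst)))
    exact h1.mul (Complex.continuous_conj.measurable.comp h2)
  exact (hG.stronglyMeasurable.integral_prod_right' (ν := (volume : Measure Space))).measurable

/-- **Iterated form** (Tonelli): `swapPurity n Ψ = ∫ dŶ ∫ dŶ' |⟨Ψ_Ŷ', Ψ_Ŷ⟩|²` with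
`⟨Ψ_Ŷ', Ψ_Ŷ⟩ = ∫ conj Ψ(x, Ŷ') Ψ(x, Ŷ) dx` — the shape in which the sibling route `BECSwapOverlap`
inlines the same quantity. [cite: PenroseOnsager1956, §4 (6)] -/
theorem swapPurity_eq_lintegral_lintegral {Ψ : Config (n + 1) → ℂ} (hΨ : Measurable Ψ) :
    swapPurity n Ψ = ∫⁻ Y : Config n, ∫⁻ Y' : Config n,
      (‖∫ x, conj (Ψ (Matrix.vecCons x Y')) * Ψ (Matrix.vecCons x Y)‖₊ : ℝ≥0∞) ^ 2 := by
  rw [swapPurity, Measure.volume_eq_prod, lintegral_prod _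
    ((measurable_swapKernel hΨ).nnnorm.coe_nnreal_ennreal.pow_const 2).aemeasurable]
  simp_rw [mul_comm _ (conj _)]

/-! ### Cauchy–Schwarz: `swapPurity ≤ ‖Ψ‖₂⁴` -/

/-- Cauchy–Schwarz in `ℝ≥0∞`: `(∫ f g)² ≤ ∫ f² · ∫ g²`. [folklore] -/
theorem lintegral_mul_sq_le {α : Type*} [MeasurableSpace α] (ν : Measure α) {f g : α → ℝ≥0∞}
    (hf : AEMeasurable f ν) (hg : AEMeasurable g ν) :
    (∫⁻ a, f a * g a ∂ν) ^ 2 ≤ (∫⁻ a, f a ^ 2 ∂ν) * ∫⁻ a, g a ^ 2 ∂ν := by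
  have h := ENNReal.lintegral_mul_le_Lp_mul_Lq ν Real.HolderConjugate.two_two hf hg
  simp only [Pi.mul_apply] at h
  calc (∫⁻ a, f a * g a ∂ν) ^ 2
      ≤ ((∫⁻ a, f a ^ (2 : ℝ) ∂ν) ^ (1 / (2 : ℝ)) *
          (∫⁻ a, g a ^ (2 : ℝ) ∂ν) ^ (1 / (2 : ℝ))) ^ 2 := by
        gcongr
    _ = (∫⁻ a, f a ^ 2 ∂ν) * ∫⁻ a, g a ^ 2 ∂ν := by
        rw [mul_pow, ← ENNReal.rpow_two, ← ENNReal.rpow_two, ← ENNReal.rpow_mul,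
          ← ENNReal.rpow_mul]
        norm_num

/-- **`|⟨g, f⟩|² ≤ ‖f‖₂² ‖g‖₂²`** for the pairing `∫ f conj(g)` of two a.e.-measurable functions
(the Bochner integral being `0` when `f conj(g)` is not integrable). [folklore] -/
theorem sq_nnnorm_integral_mul_conj_le {α : Type*} [MeasurableSpace α] {ν : Measure α}
    {f g : α → ℂ} (hf : AEMeasurable f ν) (hg : AEMeasurable g ν) :
    (‖∫ a, f a * conj (g a) ∂ν‖₊ : ℝ≥0∞) ^ 2 ≤
      (∫⁻ a, (‖f a‖₊ : ℝ≥0∞) ^ 2 ∂ν) * ∫⁻ a, (‖g a‖₊ : ℝ≥0∞) ^ 2 ∂ν := by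
  calc (‖∫ a, f a * conj (g a) ∂ν‖₊ : ℝ≥0∞) ^ 2
      ≤ (∫⁻ a, (‖f a * conj (g a)‖₊ : ℝ≥0∞) ∂ν) ^ 2 := by
        gcongr
        exact enorm_integral_le_lintegral_enorm _
    _ = (∫⁻ a, (‖f a‖₊ : ℝ≥0∞) * ‖g a‖₊ ∂ν) ^ 2 := by
        congr 1
        refine lintegral_congr fun a => ?_
        rw [nnnorm_mul, ENNReal.coe_mul, RCLike.nnnorm_conj]
    _ ≤ _ := lintegral_mul_sq_le ν hf.nnnorm.coe_nnreal_ennreal hg.nnnorm.coe_nnreal_ennreal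

/-- **`swapPurity ≤ ‖Ψ‖₂⁴`**: by Cauchy–Schwarz `|K(X̂, Ŷ)|² ≤ ‖Ψ_X̂‖₂² ‖Ψ_Ŷ‖₂²`, and the slice
norms integrate to `‖Ψ‖₂²` each (Tonelli). [cite: PenroseOnsager1956, §4 (5)–(6)] -/
theorem swapPurity_le_lintegral_sq {Ψ : Config (n + 1) → ℂ} (hΨ : Measurable Ψ) :
    swapPurity n Ψ ≤ (∫⁻ Z, (‖Ψ Z‖₊ : ℝ≥0∞) ^ 2) ^ 2 := by
  set w : Config n → ℝ≥0∞ := fun Y => ∫⁻ x : Space, (‖Ψ (Matrix.vecCons x Y)‖₊ : ℝ≥0∞) ^ 2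
    with hw
  have hwm : Measurable w := measurable_lintegral_sq_nnnorm_vecCons hΨ
  calc swapPurity n Ψ ≤ ∫⁻ P : Config n × Config n, w P.1 * w P.2 :=
        lintegral_mono fun P => sq_nnnorm_integral_mul_conj_le
          (measurable_comp_vecCons_left hΨ P.1).aemeasurable
          (measurable_comp_vecCons_left hΨ P.2).aemeasurable
    _ = (∫⁻ Y, w Y) * ∫⁻ Y, w Y := by
        rw [Measure.volume_eq_prod, lintegral_prod_mul hwm.aemeasurable hwm.aemeasurable]
    _ = (∫⁻ Z, (‖Ψ Z‖₊ : ℝ≥0∞) ^ 2) ^ 2 := by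
        rw [hw, lintegral_lintegral_sq_nnnorm_vecCons hΨ, sq]

/-- **`swapPurity ≤ 1` for (sub)normalised `Ψ`** (`‖Ψ‖₂ ≤ 1`): the purity `A₂ = N⁻² ∑ₐ nₐ²` of a
density matrix is at most `1`. [cite: PenroseOnsager1956, §4 (5)–(6)] -/
theorem swapPurity_le_one {Ψ : Config (n + 1) → ℂ} (hΨ : Measurable Ψ)
    (h1 : ∫⁻ Z, (‖Ψ Z‖₊ : ℝ≥0∞) ^ 2 ≤ 1) : swapPurity n Ψ ≤ 1 :=
  (swapPurity_le_lintegral_sq hΨ).trans (by simpa using pow_le_one₀ zero_le h1)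

/-- `swapPurity ≤ 1` for an admissible (normalised, `C¹`) trial state.
[cite: PenroseOnsager1956, §4 (5)–(6)] -/
theorem TrialState.swapPurity_le_one {L : ℝ} (Ψ : TrialState (n + 1) L) :
    swapPurity n Ψ.ψ ≤ 1 :=
  BoseGas.swapPurity_le_one Ψ.contDiff.continuous.measurable Ψ.norm_eq.le

/-! ### Penrose–Onsager (5): `N · swapPurity ≤ λ_max(γ_Ψ)` -/

/-- **Penrose–Onsager (5)–(6), variational form**: `∑ₐ nₐ² ≤ n_M ∑ₐ nₐ`, i.e.
`tr γ_Ψ² ≤ λ_max(γ_Ψ) tr γ_Ψ`, as `N · swapPurity n Ψ ≤ maxOccupation N Ψ · ‖Ψ‖₂²` (`N = n + 1`,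
`Ψ` measurable with `‖Ψ‖₂ < ∞`). Proof without operators: for a.e. `Ŷ` the slice
`Ψ_Ŷ = Ψ(·, Ŷ)` is in `L²`; if `‖Ψ_Ŷ‖₂ = 0` then `K(·, Ŷ) = 0`, otherwise the normalised mode
`φ_Ŷ = Ψ_Ŷ/‖Ψ_Ŷ‖₂` has `occupation N φ_Ŷ Ψ = N ∫ |K(X̂, Ŷ)|² dX̂ / ‖Ψ_Ŷ‖₂² ≤ maxOccupation N Ψ`;
integrate `dŶ` (Tonelli). [cite: PenroseOnsager1956, §4 (5)–(6)] -/
theorem succ_mul_swapPurity_le {Ψ : Config (n + 1) → ℂ} (hΨ : Measurable Ψ)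
    (hfin : ∫⁻ Z, (‖Ψ Z‖₊ : ℝ≥0∞) ^ 2 ≠ ⊤) :
    ((n + 1 : ℕ) : ℝ≥0∞) * swapPurity n Ψ ≤
      maxOccupation (n + 1) Ψ * ∫⁻ Z, (‖Ψ Z‖₊ : ℝ≥0∞) ^ 2 := by
  -- the swap kernel `K` and the slice norms `w(Ŷ) = ‖Ψ_Ŷ‖₂²`
  set K : Config n → Config n → ℂ := fun X Y =>
    ∫ x, Ψ (Matrix.vecCons x X) * conj (Ψ (Matrix.vecCons x Y)) with hK
  set w : Config n → ℝ≥0∞ := fun Y => ∫⁻ x : Space, (‖Ψ (Matrix.vecCons x Y)‖₊ : ℝ≥0∞) ^ 2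
    with hw
  have hslice : ∀ Y : Config n, Measurable fun x : Space => Ψ (Matrix.vecCons x Y) :=
    measurable_comp_vecCons_left hΨ
  have hwm : Measurable w := measurable_lintegral_sq_nnnorm_vecCons hΨ
  have hwi : ∫⁻ Y, w Y = ∫⁻ Z, (‖Ψ Z‖₊ : ℝ≥0∞) ^ 2 := lintegral_lintegral_sq_nnnorm_vecCons hΨ
  have hKm : Measurable fun P : Config n × Config n => K P.1 P.2 := measurable_swapKernel hΨ
  have hN : ((n + 1 : ℕ) : ℝ≥0∞) = (n + 1 : ℝ≥0∞) := by push_cast; rfl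
  -- the pointwise bound, for every slice of finite norm
  have key : ∀ Y : Config n, w Y ≠ ⊤ →
      ((n + 1 : ℕ) : ℝ≥0∞) * ∫⁻ X, (‖K X Y‖₊ : ℝ≥0∞) ^ 2 ≤ maxOccupation (n + 1) Ψ * w Y := by
    intro Y hY
    rcases eq_or_ne (w Y) 0 with h0 | h0
    · -- the slice vanishes a.e., hence so does `K(·, Ŷ)`
      have hae : ∀ᵐ x : Space, Ψ (Matrix.vecCons x Y) = 0 := by
        have h := (lintegral_eq_zero_iff ((hslice Y).nnnorm.coe_nnreal_ennreal.pow_const 2)).1 h0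
        filter_upwards [h] with x hx
        simpa using hx
      have hK0 : ∀ X, K X Y = 0 := fun X => by
        simp only [hK]
        refine integral_eq_zero_of_ae ?_
        filter_upwards [hae] with x hx
        simp [hx]
      simp [hK0]
    · -- normalise the slice: `φ = k Ψ_Ŷ`, `k = ‖Ψ_Ŷ‖₂⁻¹`
      set c : ℝ≥0 := (w Y).toNNReal with hc
      have hcw : (c : ℝ≥0∞) = w Y := ENNReal.coe_toNNReal hY
      have hc0 : c ≠ 0 := by
        intro h
        rw [h, ENNReal.coe_zero] at hcw
        exact h0 hcw.symm
      set k : ℝ≥0 := (NNReal.sqrt c)⁻¹ with hk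
      have hsq : NNReal.sqrt c ≠ 0 := by simpa using hc0
      have hk2 : (k : ℝ≥0∞) ^ 2 = (w Y)⁻¹ := by
        rw [← hcw, hk, ENNReal.coe_inv hsq, ← ENNReal.inv_pow, ← ENNReal.coe_pow, NNReal.sq_sqrt]
      have hknorm : ∀ z : ℂ, (‖(k : ℂ) * z‖₊ : ℝ≥0∞) = k * ‖z‖₊ := by
        intro z
        rw [nnnorm_mul, ENNReal.coe_mul]
        congr 2
        rw [show ((k : ℂ)) = ((k : ℝ) : ℂ) from rfl, Complex.nnnorm_real, NNReal.nnnorm_eq]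
      set φ : Space → ℂ := fun x => (k : ℂ) * Ψ (Matrix.vecCons x Y) with hφ
      have hφm : AEStronglyMeasurable φ volume :=
        (measurable_const.mul (hslice Y)).aestronglyMeasurable
      have hφ1 : ∫⁻ x, (‖φ x‖₊ : ℝ≥0∞) ^ 2 = 1 := by
        have h1 : ∀ x, (‖φ x‖₊ : ℝ≥0∞) ^ 2 =
            (k : ℝ≥0∞) ^ 2 * (‖Ψ (Matrix.vecCons x Y)‖₊ : ℝ≥0∞) ^ 2 := by
          intro x
          rw [hφ, hknorm, mul_pow]
        simp_rw [h1]
        rw [lintegral_const_mul _ ((hslice Y).nnnorm.coe_nnreal_ennreal.pow_const 2), hk2]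
        exact ENNReal.inv_mul_cancel h0 hY
      -- the occupation of `φ` is `N k² ∫ |K(X̂, Ŷ)|² dX̂`
      have hpair : ∀ X : Config n,
          ∫ x, conj (φ x) * Ψ (Matrix.vecCons x X) = (k : ℂ) * K X Y := by
        intro X
        simp only [hφ, hK]
        rw [← integral_const_mul]
        refine integral_congr_ae (Filter.Eventually.of_forall fun x => ?_)
        simp only [map_mul]
        rw [show ((k : ℂ)) = ((k : ℝ) : ℂ) from rfl, Complex.conj_ofReal]
        ring
      have hocc : occupation (n + 1) φ Ψ =
          ((n + 1 : ℕ) : ℝ≥0∞) * ((k : ℝ≥0∞) ^ 2 * ∫⁻ X, (‖K X Y‖₊ : ℝ≥0∞) ^ 2) := by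
        rw [hN, ← lintegral_const_mul' _ _ (by simp [hk])]
        simp only [occupation]
        congr 1
        refine lintegral_congr fun X => ?_
        rw [hpair, hknorm, mul_pow]
      have hle : occupation (n + 1) φ Ψ ≤ maxOccupation (n + 1) Ψ :=
        occupation_le_maxOccupation Ψ hφm hφ1
      calc ((n + 1 : ℕ) : ℝ≥0∞) * ∫⁻ X, (‖K X Y‖₊ : ℝ≥0∞) ^ 2
          = ((n + 1 : ℕ) : ℝ≥0∞) * ((k : ℝ≥0∞) ^ 2 * ∫⁻ X, (‖K X Y‖₊ : ℝ≥0∞) ^ 2) * w Y := by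
            rw [hk2, mul_assoc, mul_assoc, mul_comm (w Y)⁻¹, mul_assoc,
              ENNReal.mul_inv_cancel h0 hY, mul_one]
        _ = occupation (n + 1) φ Ψ * w Y := by rw [hocc]
        _ ≤ maxOccupation (n + 1) Ψ * w Y := by gcongr
  -- integrate the pointwise bound over `Ŷ` (a.e. slice has finite norm since `‖Ψ‖₂ < ∞`)
  have hae : ∀ᵐ Y : Config n, w Y < ⊤ := ae_lt_top hwm (by rwa [hwi])
  have hsp : swapPurity n Ψ = ∫⁻ P : Config n × Config n, (‖K P.1 P.2‖₊ : ℝ≥0∞) ^ 2 := rfl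
  calc ((n + 1 : ℕ) : ℝ≥0∞) * swapPurity n Ψ
      = ((n + 1 : ℕ) : ℝ≥0∞) * ∫⁻ Y, ∫⁻ X, (‖K X Y‖₊ : ℝ≥0∞) ^ 2 := by
        rw [hsp, Measure.volume_eq_prod,
          lintegral_prod_symm _ (hKm.nnnorm.coe_nnreal_ennreal.pow_const 2).aemeasurable]
    _ = ∫⁻ Y, ((n + 1 : ℕ) : ℝ≥0∞) * ∫⁻ X, (‖K X Y‖₊ : ℝ≥0∞) ^ 2 := by
        rw [lintegral_const_mul' _ _ (by simp)]
    _ ≤ ∫⁻ Y, maxOccupation (n + 1) Ψ * w Y := by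
        refine lintegral_mono_ae ?_
        filter_upwards [hae] with Y hY
        exact key Y hY.ne
    _ = maxOccupation (n + 1) Ψ * ∫⁻ Z, (‖Ψ Z‖₊ : ℝ≥0∞) ^ 2 := by
        rw [lintegral_const_mul _ hwm, hwi]

/-- **`N · swapPurity ≤ λ_max(γ_Ψ)` for (sub)normalised `Ψ`** (`‖Ψ‖₂ ≤ 1`):
`tr γ_Ψ² ≤ N λ_max(γ_Ψ)`, Penrose–Onsager's `A₂ ≤ n_M/N`. [cite: PenroseOnsager1956, §4 (5)–(6)] -/
theorem succ_mul_swapPurity_le_maxOccupation {Ψ : Config (n + 1) → ℂ} (hΨ : Measurable Ψ)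
    (h1 : ∫⁻ Z, (‖Ψ Z‖₊ : ℝ≥0∞) ^ 2 ≤ 1) :
    ((n + 1 : ℕ) : ℝ≥0∞) * swapPurity n Ψ ≤ maxOccupation (n + 1) Ψ :=
  (succ_mul_swapPurity_le hΨ (ne_top_of_le_ne_top ENNReal.one_ne_top h1)).trans
    (mul_le_of_le_one_right zero_le h1)

/-- `N · swapPurity ≤ λ_max(γ_Ψ)` for an admissible (normalised, `C¹`) trial state — the form of
item `TraceSqLower` of route `BECSwapAffinity`. [cite: PenroseOnsager1956, §4 (5)–(6)] -/
theorem TrialState.succ_mul_swapPurity_le_maxOccupation {L : ℝ} (Ψ : TrialState (n + 1) L) :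
    ((n + 1 : ℕ) : ℝ≥0∞) * swapPurity n Ψ.ψ ≤ maxOccupation (n + 1) Ψ.ψ :=
  BoseGas.succ_mul_swapPurity_le_maxOccupation Ψ.contDiff.continuous.measurable Ψ.norm_eq.le

/-! ### The Bhattacharyya form for real nonnegative `Ψ` -/

/-- `X̂ ↦ tail`: dropping the first coordinate is measurable. [folklore] -/
theorem measurable_vecTail : Measurable fun Z : Config (n + 1) => Matrix.vecTail Z :=
  measurable_pi_lambda _ fun i => measurable_pi_apply (Fin.succ i)

/-- Replacing the first coordinate: `Z[0 ↦ y] = y :: tail Z`. [folklore] -/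
theorem update_zero_eq_vecCons (Z : Config (n + 1)) (y : Space) :
    Function.update Z 0 y = Matrix.vecCons y (Matrix.vecTail Z) := by
  conv_lhs => rw [← Matrix.cons_head_tail Z]
  exact Fin.update_cons_zero _ _ _

/-- **The swap purity as a Bhattacharyya affinity.** For real nonnegative `Ψ ∈ L²`,
`swapPurity n Ψ = ∫∫ Ψ(Z₁) Ψ(Z₂) Ψ(Z₁[0 ↦ z₂]) Ψ(Z₂[0 ↦ z₁]) dZ₁ dZ₂ = ∫ √(p · p∘T) d(Z₁, Z₂)`,
where `z₁ = Z₁ 0`, `z₂ = Z₂ 0`, `p = Ψ² ⊗ Ψ²` is the two-replica density and `T` exchanges the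
first coordinate between the replicas (`p∘T (Z₁, Z₂) = Ψ(Z₁[0 ↦ z₂])² Ψ(Z₂[0 ↦ z₁])²`): expand
`|K(X̂, Ŷ)|² = ∫∫ Ψ(x, X̂) Ψ(x, Ŷ) Ψ(y, X̂) Ψ(y, Ŷ) dx dy` (valid for a.e. `(X̂, Ŷ)`, where both
slices are in `L²`) and regroup `Z₁ = x :: X̂`, `Z₂ = y :: Ŷ` (Tonelli). This is the two-replica
representation `⟨Ψ ⊗ Ψ| Π₂^A |Ψ ⊗ Ψ⟩ = e^{-S₂(A)} = tr ρ_A²` of Herdman et al. for the one-particle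
subset `A` (their permutation operator `Π₂^A` exchanges the coordinates of `A` between the two
replicas), written out for a real nonnegative wave function.
[cite: HerdmanEtAl2014, §II (Π₂^A and ⟨Ψ,Ψ̃|Π₂^A|Ψ,Ψ̃⟩ = e^{-S₂}), n = 1] -/
theorem swapPurity_eq_lintegral_of_nonneg {Ψ : Config (n + 1) → ℂ} (hΨ : Measurable Ψ)
    (hreal : ∀ Z, Ψ Z = (‖Ψ Z‖ : ℂ)) (hfin : ∫⁻ Z, (‖Ψ Z‖₊ : ℝ≥0∞) ^ 2 ≠ ⊤) :
    swapPurity n Ψ = ∫⁻ Z : Config (n + 1) × Config (n + 1),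
      (‖Ψ Z.1‖₊ : ℝ≥0∞) * ‖Ψ Z.2‖₊ * ‖Ψ (Function.update Z.1 0 (Z.2 0))‖₊ *
        ‖Ψ (Function.update Z.2 0 (Z.1 0))‖₊ := by
  -- notation: slices `A X̂ x = |Ψ(x :: X̂)|`, quartic integrand `H`, kernel `K`, slice norms `w`
  set G : Config (n + 1) × Config (n + 1) → ℝ≥0∞ := fun Z =>
    (‖Ψ Z.1‖₊ : ℝ≥0∞) * ‖Ψ Z.2‖₊ * ‖Ψ (Function.update Z.1 0 (Z.2 0))‖₊ *
      ‖Ψ (Function.update Z.2 0 (Z.1 0))‖₊ with hG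
  set A : Config n → Space → ℝ≥0∞ := fun X x => (‖Ψ (Matrix.vecCons x X)‖₊ : ℝ≥0∞) with hA
  set H : Config n → Config n → Space → Space → ℝ≥0∞ :=
    fun X Y x y => A X x * A Y x * (A X y * A Y y) with hH
  set K : Config n → Config n → ℂ := fun X Y =>
    ∫ x, Ψ (Matrix.vecCons x X) * conj (Ψ (Matrix.vecCons x Y)) with hK
  set w : Config n → ℝ≥0∞ := fun Y => ∫⁻ x : Space, (‖Ψ (Matrix.vecCons x Y)‖₊ : ℝ≥0∞) ^ 2
    with hw
  have hslice : ∀ Y : Config n, Measurable fun x : Space => Ψ (Matrix.vecCons x Y) :=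
    measurable_comp_vecCons_left hΨ
  have hwm : Measurable w := measurable_lintegral_sq_nnnorm_vecCons hΨ
  have hwi : ∫⁻ Y, w Y = ∫⁻ Z, (‖Ψ Z‖₊ : ℝ≥0∞) ^ 2 := lintegral_lintegral_sq_nnnorm_vecCons hΨ
  have hKm : Measurable fun P : Config n × Config n => K P.1 P.2 := measurable_swapKernel hΨ
  have hae : ∀ᵐ Y : Config n, w Y < ⊤ := ae_lt_top hwm (by rwa [hwi])
  have hAm : Measurable fun q : Config n × Space => A q.1 q.2 :=
    (hΨ.comp (measurable_vecCons.comp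
      (measurable_snd.prodMk measurable_fst))).nnnorm.coe_nnreal_ennreal
  have hAY : ∀ Y : Config n, Measurable (A Y) := fun Y => (hslice Y).nnnorm.coe_nnreal_ennreal
  -- Step 1: `|K(X̂, Ŷ)|² = ∫∫ H` whenever both slices are in `L²`
  have step1 : ∀ X Y : Config n, w X ≠ ⊤ → w Y ≠ ⊤ →
      (‖K X Y‖₊ : ℝ≥0∞) ^ 2 = ∫⁻ x, ∫⁻ y, H X Y x y := by
    intro X Y hX hY
    set r : Space → ℝ := fun x => ‖Ψ (Matrix.vecCons x X)‖ * ‖Ψ (Matrix.vecCons x Y)‖ with hr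
    have hr0 : ∀ x, 0 ≤ r x := fun x => mul_nonneg (norm_nonneg _) (norm_nonneg _)
    have hrm : Measurable r := (hslice X).norm.mul (hslice Y).norm
    have hrg : ∀ x, ENNReal.ofReal (r x) = A X x * A Y x := by
      intro x
      rw [hr, ENNReal.ofReal_mul (norm_nonneg _), ofReal_norm, ofReal_norm, enorm_eq_nnnorm,
        enorm_eq_nnnorm]
    have hg2 : (∫⁻ x, A X x * A Y x) ^ 2 ≤ w X * w Y :=
      lintegral_mul_sq_le volume (hAY X).aemeasurable (hAY Y).aemeasurable
    have hglt : ∫⁻ x, A X x * A Y x < ⊤ := by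
      have h2 : (∫⁻ x, A X x * A Y x) ^ 2 < ⊤ :=
        lt_of_le_of_lt hg2 (ENNReal.mul_lt_top hX.lt_top hY.lt_top)
      by_contra h
      rw [not_lt, top_le_iff] at h
      rw [h] at h2
      simp at h2
    have hri : Integrable r volume := by
      refine ⟨hrm.aestronglyMeasurable, ?_⟩
      show ∫⁻ x, ‖r x‖ₑ < ⊤
      calc ∫⁻ x, ‖r x‖ₑ = ∫⁻ x, A X x * A Y x :=
            lintegral_congr fun x => by rw [Real.enorm_eq_ofReal (hr0 x), hrg]
        _ < ⊤ := hglt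
    have hKr : K X Y = ((∫ x, r x : ℝ) : ℂ) := by
      simp only [hK, hr]
      rw [← integral_complex_ofReal]
      refine integral_congr_ae (Filter.Eventually.of_forall fun x => ?_)
      show Ψ (Matrix.vecCons x X) * conj (Ψ (Matrix.vecCons x Y)) =
        ((‖Ψ (Matrix.vecCons x X)‖ * ‖Ψ (Matrix.vecCons x Y)‖ : ℝ) : ℂ)
      conv_lhs => rw [hreal (Matrix.vecCons x X), hreal (Matrix.vecCons x Y)]
      rw [Complex.conj_ofReal, ← Complex.ofReal_mul]
    have hI0 : 0 ≤ ∫ x, r x := integral_nonneg hr0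
    calc (‖K X Y‖₊ : ℝ≥0∞) ^ 2 = (ENNReal.ofReal (∫ x, r x)) ^ 2 := by
          rw [hKr, Complex.nnnorm_real, ← enorm_eq_nnnorm, ← ofReal_norm, Real.norm_of_nonneg hI0]
      _ = (∫⁻ x, A X x * A Y x) ^ 2 := by
          rw [ofReal_integral_eq_lintegral_ofReal hri (Filter.Eventually.of_forall hr0)]
          simp_rw [hrg]
      _ = ∫⁻ x, ∫⁻ y, H X Y x y := by
          rw [sq, ← lintegral_lintegral_mul (f := fun x => A X x * A Y x)
            (g := fun y => A X y * A Y y) ((hAY X).mul (hAY Y)).aemeasurable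
            ((hAY X).mul (hAY Y)).aemeasurable]
  -- Step 2: the left-hand side as an iterated integral, `∫ dX̂ ∫ dx ∫ dŶ ∫ dy H`
  have hHm : ∀ X : Config n, Measurable (Function.uncurry fun Y x => ∫⁻ y, H X Y x y) := by
    intro X
    have m1 : Measurable fun t : (Config n × Space) × Space => A X t.1.2 :=
      hAm.comp (measurable_const.prodMk (measurable_snd.comp measurable_fst))
    have m2 : Measurable fun t : (Config n × Space) × Space => A t.1.1 t.1.2 :=
      hAm.comp ((measurable_fst.comp measurable_fst).prodMk (measurable_snd.comp measurable_fst))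
    have m3 : Measurable fun t : (Config n × Space) × Space => A X t.2 :=
      hAm.comp (measurable_const.prodMk measurable_snd)
    have m4 : Measurable fun t : (Config n × Space) × Space => A t.1.1 t.2 :=
      hAm.comp ((measurable_fst.comp measurable_fst).prodMk measurable_snd)
    have hF : Measurable fun t : (Config n × Space) × Space => H X t.1.1 t.1.2 t.2 :=
      (m1.mul m2).mul (m3.mul m4)
    exact hF.lintegral_prod_right'
  have hsp : swapPurity n Ψ = ∫⁻ P : Config n × Config n, (‖K P.1 P.2‖₊ : ℝ≥0∞) ^ 2 := rfl
  have lhs : swapPurity n Ψ = ∫⁻ X, ∫⁻ x, ∫⁻ Y, ∫⁻ y, H X Y x y := by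
    rw [hsp, Measure.volume_eq_prod,
      lintegral_prod _ (hKm.nnnorm.coe_nnreal_ennreal.pow_const 2).aemeasurable]
    refine lintegral_congr_ae ?_
    filter_upwards [hae] with X hX
    calc ∫⁻ Y, (‖K X Y‖₊ : ℝ≥0∞) ^ 2 = ∫⁻ Y, ∫⁻ x, ∫⁻ y, H X Y x y :=
          lintegral_congr_ae (by
            filter_upwards [hae] with Y hY
            exact step1 X Y hX.ne hY.ne)
      _ = ∫⁻ x, ∫⁻ Y, ∫⁻ y, H X Y x y := lintegral_lintegral_swap (hHm X).aemeasurable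
  -- Step 3: the right-hand side as the same iterated integral (split `Z₁ = x :: X̂`, `Z₂ = y :: Ŷ`)
  have hupd : ∀ (Z : Config (n + 1)) (y : Space),
      Function.update Z 0 y = Matrix.vecCons y (Matrix.vecTail Z) := update_zero_eq_vecCons
  have hGm : Measurable G := by
    have h1 : Measurable fun Z : Config (n + 1) × Config (n + 1) => (‖Ψ Z.1‖₊ : ℝ≥0∞) :=
      (hΨ.comp measurable_fst).nnnorm.coe_nnreal_ennreal
    have h2 : Measurable fun Z : Config (n + 1) × Config (n + 1) => (‖Ψ Z.2‖₊ : ℝ≥0∞) :=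
      (hΨ.comp measurable_snd).nnnorm.coe_nnreal_ennreal
    have hp3 : Measurable fun Z : Config (n + 1) × Config (n + 1) => (Z.2 0, Matrix.vecTail Z.1) :=
      ((measurable_pi_apply 0).comp measurable_snd).prodMk (measurable_vecTail.comp measurable_fst)
    have hp4 : Measurable fun Z : Config (n + 1) × Config (n + 1) => (Z.1 0, Matrix.vecTail Z.2) :=
      ((measurable_pi_apply 0).comp measurable_fst).prodMk (measurable_vecTail.comp measurable_snd)
    have hu3 : Measurable fun Z : Config (n + 1) × Config (n + 1) =>
        Matrix.vecCons (Z.2 0) (Matrix.vecTail Z.1) := measurable_vecCons.comp hp3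
    have hu4 : Measurable fun Z : Config (n + 1) × Config (n + 1) =>
        Matrix.vecCons (Z.1 0) (Matrix.vecTail Z.2) := measurable_vecCons.comp hp4
    have h3 : Measurable fun Z : Config (n + 1) × Config (n + 1) =>
        (‖Ψ (Function.update Z.1 0 (Z.2 0))‖₊ : ℝ≥0∞) := by
      simp_rw [hupd]
      exact (hΨ.comp hu3).nnnorm.coe_nnreal_ennreal
    have h4 : Measurable fun Z : Config (n + 1) × Config (n + 1) =>
        (‖Ψ (Function.update Z.2 0 (Z.1 0))‖₊ : ℝ≥0∞) := by
      simp_rw [hupd]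
      exact (hΨ.comp hu4).nnnorm.coe_nnreal_ennreal
    exact ((h1.mul h2).mul h3).mul h4
  have rhs : ∫⁻ Z, G Z = ∫⁻ X, ∫⁻ x, ∫⁻ Y, ∫⁻ y, H X Y x y := by
    rw [Measure.volume_eq_prod, lintegral_prod _ hGm.aemeasurable,
      lintegral_config_succ hGm.lintegral_prod_right']
    refine lintegral_congr fun X => lintegral_congr fun x => ?_
    rw [lintegral_config_succ (F := fun Z₂ => G (Matrix.vecCons x X, Z₂))
      (hGm.comp (measurable_const.prodMk measurable_id))]
    refine lintegral_congr fun Y => lintegral_congr fun y => ?_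
    simp only [hG, hH, hA, hupd, Matrix.tail_cons, Matrix.cons_val_zero]
    ring
  rw [lhs, rhs]

end Literature.MathematicalPhysics.QuantumManyBody.BoseGas

end

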